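import Summits.QuantumFields.BalabanUV.Beta.D1BFx.RestKernelGhostDeltaSharp
import Summits.QuantumFields.BalabanUV.Beta.D1BFx.BlockGaugeEnvelope

/-!
# `BalabanUV.Beta.D1BFx.GhostGaugeVariationSharp` — road «BF-x» for binder row D1, slot (K), GHOST-N8-SPEC v0.4 §3 (d3-BR, bm pin), LETTERS + WORDS:
# **C2's FOUR FROZEN-AVERAGING COMMUTATOR WORDS SEPARATING THE bm PIN FROM THE STRAIGHT PIN ARE `O(n⁻⁸)` ON THE SCALES `n = L^k`** — the commutator
# `[P_a, χ̂_{μ,y}](x,z′) = (χ̂_{μ,y}(z′) − χ̂_{μ,y}(x))·(a∕n⁴)·1[blk x = blk z′]` is a BLOCK-LOCAL CENTRED DENSITY `≲ |a|·n⁻⁸` by FILE A's envelope ALONE (no gradient of `χ̂`),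
# hence of the same shape as L-Q′'s packed `Q′`-vertex, and (Δ2)∕(Δ3)'s machinery prices the words exactly as it priced ΔGH's

HONEST DEPENDENCY (cell records, verbatim): «continuum YM on T⁴ ⇐ BetaPertH ∧ nine spine estimates (0/9 proved); BetaPertH ⇐ (D1) ∧ (D4) ∧
CAP+tail; G-an2-4 gates asym, D1 and NE2/3/4.»  HONEST FRAMING (cell contract, verbatim): «discharging `BetaPertH` makes Bałaban's UV stability
UNCONDITIONAL — a real constructive-QFT result; it is NOT the continuum limit and NOT the Clay problem.»  THIS MODULE DISCHARGES NOTHING of the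
wall: [folklore] composition BY NAME of leaf-04 g22's FILE A `BlockGaugeEnvelope.abs_bmGauge_colH_K₀_le'` (the block gauge function's envelope `≲ n⁻⁴`), this
lineage's (Δ1) `GhostQVertexDensity.exp_centre_blockmate`, (Δ2) `GhostQWordLetters` (generic block-density majorant, `K`-side, generic tadpole), (Δ3)
`RestKernelGhostDeltaSharp.fourTerm_bookkeeping`, F2 `OrientedProfileWords.decay510_biBubble_of_twoTerm`, F5 P2's `K_diff_le ∕ K_value_le` and an3∕gan24-leaf-05's
`GhostLegBlockMass.sum_B_abs_Ggh_le`; β2's leg letters are DISPLAYED hypotheses.  No definition, no `def … : Prop`, nothing cited, 0 sorry.  0 root-level binders of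
row D1 discharged (hW ∕ hR-sockets ∕ hSX-socket ∕ D1Tel ∕ D1Rep = 0); (K) NOT closed; NOT D1, NOT `BetaPertH`, NOT continuum, NOT Clay.

ABSOLUTE RULE (cell charter, verbatim): «No internally-minted statement may enter as a cited fact. Every hypothesis is either kernel-proved in
this package or a verbatim quotation of a PUBLISHED theorem with page reference. The manuscript(s) under audit are NOT citable for their own
disputed steps — they are the thing under adjudication; programme-internal (2001/route/tribunal) claims are never citable.»

WHY (journal A-1 to INTENT-2 [D1LEAF04-G27-INTENT-2-A1], INTENT-5).  By C3 `GhostBracketGaugeSplit.BR_G₀_eq_BR_K₀_add` the bm-DRESSED bracket `BR[colH G₀]` — which IS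
the (J3) rest at the tower weight (`GhostDeficitFormula.J3_of_tower_weight`: `Λ·(road ghost word) = ωgh·PghQ + 2Λ·BR[colH G₀]`) — differs from the straight-pin bracket
(Δ4 `GhostBracketRowsSharp.sharp_BR_K₀`, `K·n⁻⁸`) by C2's four words (`GhostLoopGaugeVariation.DD_K₀_sub_DD_G₀_eq_four`), priced `O(a)·n⁻¹` in leaf-04 g22's D2
`GhostGaugeVariationRows` by SUP × MASS.  GHOST-N8-SPEC v0.3 §3 expected them to need L-h♭ (a gradient of `χ̂`) at `n⁻⁸`; the entrywise count says otherwise: the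
commutator's two `χ̂` values are each `≲ n⁻⁴` (FILE A), the frozen averaging contributes `a∕n⁴` on the common block, so the vertex is `≲ |a|·n⁻⁸·E_y(z′)` block-locally —
VERBATIM the hypothesis shape of (Δ2)'s `abs_comp_Ggh_blockDensity_le`; the double-commutator table is `≲ |a|·n⁻¹²·E_0(x)E_z(x)` — the shape of (Δ2)'s generic tadpole.

CONTENT ([folklore]; `n = m + 1`, `N := (n : ℝ)`; `r ∈ box 4 n` the bm root; `κ₄ := kappa163 4`; `Cχ := 8·(MG163 4·periodConst (kappa163 4) 3·e^{κ₄∕4})·e^{2(κ₄∕4)}` FILE A's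
constant; `E_y(w) := e^{−((κ₄∕16)∕N)‖w − N•y‖∞}`; `χ̂_{μ,y} := bmGaugeAt (toSite r) (colH (KInvStep n 0) n μ y) n`).
* §1 `abs_bmGauge_le_supNorm` (FILE A in the `supNorm` currency), **`abs_chiComm_le`** (`|[P_a, χ̂_{μ,y}](x,z′)| ≤ (|a|·(Cχ·(1 + e^{κ₄∕4}))·(N⁴)⁻¹·(N⁴)⁻¹)·E_y(z′)`),
  `chiComm_eq_zero_of_blk_ne`, **`abs_chiComm₂_le`** (the double-commutator table `≤ (|a|·(Cχ·(1+e^{κ₄∕4}))²·(N⁴)⁻¹·(N⁴)⁻¹·(N⁴)⁻¹)·E_0(x)·E_z(x)`), `chiComm₂_eq_zero_of_blk_ne`.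
* §2 **`sharp_chiCross₁`**, **`sharp_chiCross₂`**, **`sharp_chiPure`** (`∃ K, ∀ k ≥ 1, ∀ m, m+1 = L^k → ∀ r ∈ box 4 n, ∀ μ ν, Decay510 (word) (K·(N⁸)⁻¹) r₀`; the `K`-vertex
  written `vertexRedF n (SghAt (ctrHalf n) n N² 0)` — D2's `packD_K₀_eq_vertexRedF` is the bridge to C2's `colH` spelling), **`decay510_chiTadpole_pow`** (explicit `K_T·(N⁸)⁻¹`).
NOT HERE (honest): the assembly `DD[K₀] − DD[G₀]` and the bm-pin bracket row (`GhostBracketRowsBmSharp`); the value of `K`; scales `n ∉ {L^k}`; anything of the END.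
Unit `b2b-balaban-beta-d1-formalise-leaf-04` (gen 27), D1 formalisation swarm, road «BF-x»; INTENT-5 [D1LEAF04-G27-INTENT-5]. Not in print; no existing file touched.
-/

noncomputable section

namespace Summit.QuantumFields.BalabanUV.Beta.D1BFx.GhostGaugeVariationSharp

open scoped BigOperators
open Finset
open Literature.MathematicalPhysics.QuantumFieldTheory.Balaban1983to89
open Literature.MathematicalPhysics.QuantumFieldTheory.Balaban1983to89.Beta
open B12Sec2to5 (l1 l1_nonneg Decay510)
open B5Hk163Strip (kappa163 kappa163_pos)
open B5Hk163TorusHolderDecay (MD163)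
open B5Hk163Decay (MG163)
open B4TorusKernel (periodConst)
open B6QGQLower276 (blk B mem_B sameBlk)
open ExpKernelCalculus (Site MKer comp tr tadpole bubble decay510_mono_const)
open AffineAveraging (box toSite unitVec)
open OneStepKernelFamily (KInvStep colH)
open PoissonInterior (supNorm nrm nrm_pos)
open Summit.QuantumFields.BalabanUV.Beta.AxialProjectorBlockMean (bmGaugeAt)
open Summit.QuantumFields.BalabanUV.Beta.D1BFx.PackedKernelSplit (biBubble)
open Summit.QuantumFields.BalabanUV.Beta.D1BFx.GhostLeg (Ggh)
open Summit.QuantumFields.BalabanUV.Beta.D1BFx.GhostStencilRooted (SghAt)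
open Summit.QuantumFields.BalabanUV.Beta.D1BFx.GhostStencilRootedReflection (ctrHalf)
open Summit.QuantumFields.BalabanUV.Beta.D1BFx.ReducedKernelF (vertexRedF)
open Summit.QuantumFields.BalabanUV.Beta.D1BFx.GhostVertexDensities (exp_l1_le_exp_supNorm road_rate_eq)
open Summit.QuantumFields.BalabanUV.Beta.D1BFx.OrientedProfileWords (decay510_biBubble_of_twoTerm)
open Summit.QuantumFields.BalabanUV.Beta.D1BFx.GhostRowBookkeeping (K_diff_le K_value_le)
open Summit.QuantumFields.BalabanUV.Beta.D1BFx.GhostLegBlockMass (cNear sum_B_abs_Ggh_le)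
open Summit.QuantumFields.BalabanUV.Beta.D1BFx.GhostLegFree (ghDelta_pos)
open Summit.QuantumFields.BalabanUV.Beta.D1BFx.BlockGaugeEnvelope (abs_bmGauge_colH_K₀_le')
open Summit.QuantumFields.BalabanUV.Beta.D1BFx.GhostQVertexDensity (exp_centre_blockmate)
open Summit.QuantumFields.BalabanUV.Beta.D1BFx.GhostQWordLetters (abs_comp_Ggh_blockDensity_le abs_comp_Ggh_VK_le abs_tadpole_le_of_blockRow_blockTable cNear_pos)
open Summit.QuantumFields.BalabanUV.Beta.D1BFx.RestKernelGhostDeltaSharp (M5_nonneg M6_nonneg fourTerm_bookkeeping)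

variable (m : ℕ) {a : ℝ} {r : Fin (3 + 1) → ℕ} (hr : r ∈ box (3 + 1) (m + 1))

/-! ## §1 The frozen-averaging commutator `[P_a, χ̂]` is a block-local centred density `≲ |a|·n⁻⁸` -/

section Letters
include hr

/-- [folklore] **FILE A's ENVELOPE IN THE `supNorm` CURRENCY**: `|χ̂_{μ,y}(w)| ≤ Cχ·(N⁴)⁻¹·e^{−((κ₄∕16)∕N)‖w − N•y‖∞}` (`abs_bmGauge_colH_K₀_le'`, `road_rate_eq`, `|·|₁ ≥ ‖·‖∞`). -/
theorem abs_bmGauge_le_supNorm (μ : Fin 4) (y w : Site 4) :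
    |bmGaugeAt (toSite r) (colH (KInvStep (d := 3) (m + 1) 0) (m + 1) μ y) (m + 1) w|
      ≤ 8 * ((MG163 4 * periodConst (kappa163 4) 3) * Real.exp (kappa163 4 / 4)) * Real.exp (2 * (kappa163 4 / 4)) * ((((m + 1 : ℕ) : ℝ)) ^ 4)⁻¹
        * Real.exp (-(kappa163 4 / 16 / ((m + 1 : ℕ) : ℝ)) * supNorm (w - ((m + 1 : ℕ) : ℤ) • y)) := by
  have h := abs_bmGauge_colH_K₀_le' m hr μ y w
  have e3 : (3 : ℕ) + 1 = 4 := rfl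
  have e3r : (3 : ℝ) + 1 = 4 := by norm_num
  simp only [e3, e3r, road_rate_eq] at h
  have hc : 0 ≤ kappa163 4 / 16 / ((m + 1 : ℕ) : ℝ) := by have := kappa163_pos 4; positivity
  have hK : 0 ≤ 8 * ((MG163 4 * periodConst (kappa163 4) 3) * Real.exp (kappa163 4 / 4)) * Real.exp (2 * (kappa163 4 / 4)) * ((((m + 1 : ℕ) : ℝ)) ^ 4)⁻¹ := by
    have := M5_nonneg m; positivity
  exact h.trans (mul_le_mul_of_nonneg_left (exp_l1_le_exp_supNorm hc _) hK)

/-- [folklore] **THE COMMUTATOR VERTEX IS A BLOCK-LOCAL CENTRED DENSITY**: for every `μ y x z′`,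
`|(χ̂_{μ,y}(z′) − χ̂_{μ,y}(x))·(a∕N⁴·sameBlk x z′)| ≤ (|a|·(Cχ·(1 + e^{κ₄∕4}))·(N⁴)⁻¹·(N⁴)⁻¹)·e^{−((κ₄∕16)∕N)‖z′ − N•y‖∞}` — on the common block both `χ̂` values are
`≲ N⁻⁴`, the one at `x` moved to `z′` at the price `e^{κ₄∕4}` ((Δ1) `exp_centre_blockmate`); NO gradient of `χ̂`. -/
theorem abs_chiComm_le (a : ℝ) (μ : Fin 4) (y x z' : Site 4) (g f : Unit) :
    |(fun x z' (_ _ : Unit) => (bmGaugeAt (toSite r) (colH (KInvStep (d := 3) (m + 1) 0) (m + 1) μ y) (m + 1) z'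
        - bmGaugeAt (toSite r) (colH (KInvStep (d := 3) (m + 1) 0) (m + 1) μ y) (m + 1) x)
        * (a / (((m + 1 : ℕ) : ℝ)) ^ 4 * sameBlk (m + 1 - 1) x z')) x z' g f|
      ≤ |a| * (8 * ((MG163 4 * periodConst (kappa163 4) 3) * Real.exp (kappa163 4 / 4)) * Real.exp (2 * (kappa163 4 / 4)) * (1 + Real.exp (kappa163 4 / 4)))
          * ((((m + 1 : ℕ) : ℝ)) ^ 4)⁻¹ * ((((m + 1 : ℕ) : ℝ)) ^ 4)⁻¹
        * Real.exp (-(kappa163 4 / 16 / ((m + 1 : ℕ) : ℝ)) * supNorm (z' - ((m + 1 : ℕ) : ℤ) • y)) := by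
  have hN0 : (0 : ℝ) < ((m + 1 : ℕ) : ℝ) := by exact_mod_cast Nat.succ_pos m
  set Cχ : ℝ := 8 * ((MG163 4 * periodConst (kappa163 4) 3) * Real.exp (kappa163 4 / 4)) * Real.exp (2 * (kappa163 4 / 4)) with hCχ
  set E : ℝ := Real.exp (-(kappa163 4 / 16 / ((m + 1 : ℕ) : ℝ)) * supNorm (z' - ((m + 1 : ℕ) : ℤ) • y)) with hE
  have hCχ0 : 0 ≤ Cχ := by have := M5_nonneg m; positivity
  simp only
  by_cases hb : blk (m + 1 - 1) x = blk (m + 1 - 1) z'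
  · have hs : sameBlk (m + 1 - 1) x z' = 1 := by unfold B6QGQLower276.sameBlk; rw [if_pos hb]
    rw [hs, mul_one]
    have h1 := abs_bmGauge_le_supNorm m hr μ y z'
    have h2 := (abs_bmGauge_le_supNorm m hr μ y x).trans
      (mul_le_mul_of_nonneg_left (exp_centre_blockmate m hb.symm (((m + 1 : ℕ) : ℤ) • y)) (by positivity))
    rw [abs_mul, abs_div, abs_of_pos (pow_pos hN0 4)]
    have hdiff : |bmGaugeAt (toSite r) (colH (KInvStep (d := 3) (m + 1) 0) (m + 1) μ y) (m + 1) z'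
        - bmGaugeAt (toSite r) (colH (KInvStep (d := 3) (m + 1) 0) (m + 1) μ y) (m + 1) x|
        ≤ Cχ * ((((m + 1 : ℕ) : ℝ)) ^ 4)⁻¹ * (1 + Real.exp (kappa163 4 / 4)) * E := by
      refine (abs_sub _ _).trans ?_
      have := add_le_add h1 h2
      refine this.trans (le_of_eq ?_)
      rw [hCχ, hE]; ring
    calc _ ≤ Cχ * ((((m + 1 : ℕ) : ℝ)) ^ 4)⁻¹ * (1 + Real.exp (kappa163 4 / 4)) * E * (|a| / (((m + 1 : ℕ) : ℝ)) ^ 4) :=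
          mul_le_mul_of_nonneg_right hdiff (by positivity)
      _ = _ := by rw [hCχ, hE]; ring
  · have hs : sameBlk (m + 1 - 1) x z' = 0 := by unfold B6QGQLower276.sameBlk; rw [if_neg hb]
    rw [hs, mul_zero, mul_zero, abs_zero]
    positivity

omit hr in
/-- [folklore] **SUPPORT**: off the common block the commutator vertex vanishes. -/
theorem chiComm_eq_zero_of_blk_ne (a : ℝ) (μ : Fin 4) (y : Site 4) {x z' : Site 4} (h : blk (m + 1 - 1) x ≠ blk (m + 1 - 1) z') (g f : Unit) :
    (fun x z' (_ _ : Unit) => (bmGaugeAt (toSite r) (colH (KInvStep (d := 3) (m + 1) 0) (m + 1) μ y) (m + 1) z'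
        - bmGaugeAt (toSite r) (colH (KInvStep (d := 3) (m + 1) 0) (m + 1) μ y) (m + 1) x)
        * (a / (((m + 1 : ℕ) : ℝ)) ^ 4 * sameBlk (m + 1 - 1) x z')) x z' g f = 0 := by
  have hs : sameBlk (m + 1 - 1) x z' = 0 := by unfold B6QGQLower276.sameBlk; rw [if_neg h]
  simp only [hs, mul_zero]

/-- [folklore] **THE DOUBLE-COMMUTATOR TABLE IS A BLOCK-LOCAL TWO-CENTRE DENSITY `≲ |a|·n⁻¹²`** (on its second variable, F2∕(Δ2) §3's `hW` shape): for every `p x`,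
`|(χ̂_{μ,0}(x) − χ̂_{μ,0}(p))·((χ̂_{ν,z}(x) − χ̂_{ν,z}(p))·(a∕N⁴·sameBlk p x))| ≤ (|a|·(Cχ(1+e^{κ₄∕4}))²·(N⁴)⁻¹·(N⁴)⁻¹·(N⁴)⁻¹)·E_0(x)·E_z(x)`. -/
theorem abs_chiComm₂_le (a : ℝ) (μ ν : Fin 4) (z p x : Site 4) (f g : Unit) :
    |(fun x z' (_ _ : Unit) => (bmGaugeAt (toSite r) (colH (KInvStep (d := 3) (m + 1) 0) (m + 1) μ 0) (m + 1) z'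
        - bmGaugeAt (toSite r) (colH (KInvStep (d := 3) (m + 1) 0) (m + 1) μ 0) (m + 1) x)
        * ((bmGaugeAt (toSite r) (colH (KInvStep (d := 3) (m + 1) 0) (m + 1) ν z) (m + 1) z'
            - bmGaugeAt (toSite r) (colH (KInvStep (d := 3) (m + 1) 0) (m + 1) ν z) (m + 1) x)
          * (a / (((m + 1 : ℕ) : ℝ)) ^ 4 * sameBlk (m + 1 - 1) x z'))) p x f g|
      ≤ |a| * (8 * ((MG163 4 * periodConst (kappa163 4) 3) * Real.exp (kappa163 4 / 4)) * Real.exp (2 * (kappa163 4 / 4)) * (1 + Real.exp (kappa163 4 / 4))) ^ 2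
          * ((((m + 1 : ℕ) : ℝ)) ^ 4)⁻¹ * ((((m + 1 : ℕ) : ℝ)) ^ 4)⁻¹ * ((((m + 1 : ℕ) : ℝ)) ^ 4)⁻¹
        * Real.exp (-(kappa163 4 / 16 / ((m + 1 : ℕ) : ℝ)) * supNorm (x - ((m + 1 : ℕ) : ℤ) • (0 : Site 4)))
        * Real.exp (-(kappa163 4 / 16 / ((m + 1 : ℕ) : ℝ)) * supNorm (x - ((m + 1 : ℕ) : ℤ) • z)) := by
  have hN0 : (0 : ℝ) < ((m + 1 : ℕ) : ℝ) := by exact_mod_cast Nat.succ_pos m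
  set Cχ : ℝ := 8 * ((MG163 4 * periodConst (kappa163 4) 3) * Real.exp (kappa163 4 / 4)) * Real.exp (2 * (kappa163 4 / 4)) with hCχ
  set E0 : ℝ := Real.exp (-(kappa163 4 / 16 / ((m + 1 : ℕ) : ℝ)) * supNorm (x - ((m + 1 : ℕ) : ℤ) • (0 : Site 4))) with hE0
  set Ez : ℝ := Real.exp (-(kappa163 4 / 16 / ((m + 1 : ℕ) : ℝ)) * supNorm (x - ((m + 1 : ℕ) : ℤ) • z)) with hEz
  have hCχ0 : 0 ≤ Cχ := by have := M5_nonneg m; positivity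
  simp only
  by_cases hb : blk (m + 1 - 1) p = blk (m + 1 - 1) x
  · have hs : sameBlk (m + 1 - 1) p x = 1 := by unfold B6QGQLower276.sameBlk; rw [if_pos hb]
    rw [hs, mul_one]
    have hd : ∀ (ρ : Fin 4) (c : Site 4), |bmGaugeAt (toSite r) (colH (KInvStep (d := 3) (m + 1) 0) (m + 1) ρ c) (m + 1) x
        - bmGaugeAt (toSite r) (colH (KInvStep (d := 3) (m + 1) 0) (m + 1) ρ c) (m + 1) p|
        ≤ Cχ * ((((m + 1 : ℕ) : ℝ)) ^ 4)⁻¹ * (1 + Real.exp (kappa163 4 / 4))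
          * Real.exp (-(kappa163 4 / 16 / ((m + 1 : ℕ) : ℝ)) * supNorm (x - ((m + 1 : ℕ) : ℤ) • c)) := by
      intro ρ c
      have h1 := abs_bmGauge_le_supNorm m hr ρ c x
      have h2 := (abs_bmGauge_le_supNorm m hr ρ c p).trans
        (mul_le_mul_of_nonneg_left (exp_centre_blockmate m hb.symm (((m + 1 : ℕ) : ℤ) • c)) (by positivity))
      refine (abs_sub _ _).trans ((add_le_add h1 h2).trans (le_of_eq ?_))
      rw [hCχ]; ring
    rw [abs_mul, abs_mul, abs_div, abs_of_pos (pow_pos hN0 4)]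
    have hμ := hd μ 0
    have hν := hd ν z
    have h0 : 0 ≤ Cχ * ((((m + 1 : ℕ) : ℝ)) ^ 4)⁻¹ * (1 + Real.exp (kappa163 4 / 4)) * E0 := by positivity
    calc _ ≤ (Cχ * ((((m + 1 : ℕ) : ℝ)) ^ 4)⁻¹ * (1 + Real.exp (kappa163 4 / 4)) * E0)
          * ((Cχ * ((((m + 1 : ℕ) : ℝ)) ^ 4)⁻¹ * (1 + Real.exp (kappa163 4 / 4)) * Ez) * (|a| / (((m + 1 : ℕ) : ℝ)) ^ 4)) :=
          mul_le_mul hμ (mul_le_mul_of_nonneg_right hν (by positivity)) (by positivity) h0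
      _ = _ := by rw [hE0, hEz]; ring
  · have hs : sameBlk (m + 1 - 1) p x = 0 := by unfold B6QGQLower276.sameBlk; rw [if_neg hb]
    rw [hs, mul_zero, mul_zero, mul_zero, abs_zero]
    positivity

omit hr in
/-- [folklore] **SUPPORT OF THE TABLE**: off the common block it vanishes. -/
theorem chiComm₂_eq_zero_of_blk_ne (a : ℝ) (μ ν : Fin 4) (z : Site 4) {p x : Site 4} (h : blk (m + 1 - 1) p ≠ blk (m + 1 - 1) x) (f g : Unit) :
    (fun x z' (_ _ : Unit) => (bmGaugeAt (toSite r) (colH (KInvStep (d := 3) (m + 1) 0) (m + 1) μ 0) (m + 1) z'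
        - bmGaugeAt (toSite r) (colH (KInvStep (d := 3) (m + 1) 0) (m + 1) μ 0) (m + 1) x)
        * ((bmGaugeAt (toSite r) (colH (KInvStep (d := 3) (m + 1) 0) (m + 1) ν z) (m + 1) z'
            - bmGaugeAt (toSite r) (colH (KInvStep (d := 3) (m + 1) 0) (m + 1) ν z) (m + 1) x)
          * (a / (((m + 1 : ℕ) : ℝ)) ^ 4 * sameBlk (m + 1 - 1) x z'))) p x f g = 0 := by
  have hs : sameBlk (m + 1 - 1) p x = 0 := by unfold B6QGQLower276.sameBlk; rw [if_neg h]
  simp only [hs, mul_zero]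

/-- [folklore] **THE DOUBLE-COMMUTATOR TADPOLE IN THE `n⁻⁸` CURRENCY** (`0 < a`): block-row mass `cNear a` of `Ggh` × the `n⁻¹²` table × the centre count `n⁴`
((Δ2) `abs_tadpole_le_of_blockRow_blockTable`): `Decay510 (z ↦ tadpole (Ggh n a) [[P_a, χ̂_{ν,z}], χ̂_{μ,0}]) (K_T·(N⁸)⁻¹) ((κ₄∕16)∕2∕4)`. -/
theorem decay510_chiTadpole_pow (ha : 0 < a) (μ ν : Fin 4) :
    Decay510 (fun z : Site 4 => tadpole (Ggh (m + 1) a)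
        (fun x z' (_ _ : Unit) => (bmGaugeAt (toSite r) (colH (KInvStep (d := 3) (m + 1) 0) (m + 1) μ 0) (m + 1) z'
            - bmGaugeAt (toSite r) (colH (KInvStep (d := 3) (m + 1) 0) (m + 1) μ 0) (m + 1) x)
          * ((bmGaugeAt (toSite r) (colH (KInvStep (d := 3) (m + 1) 0) (m + 1) ν z) (m + 1) z'
              - bmGaugeAt (toSite r) (colH (KInvStep (d := 3) (m + 1) 0) (m + 1) ν z) (m + 1) x)
            * (a / (((m + 1 : ℕ) : ℝ)) ^ 4 * sameBlk (m + 1 - 1) x z'))))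
      (((Fintype.card Unit : ℝ) ^ 2 *
        (cNear a * (|a| * (8 * ((MG163 4 * periodConst (kappa163 4) 3) * Real.exp (kappa163 4 / 4)) * Real.exp (2 * (kappa163 4 / 4)) * (1 + Real.exp (kappa163 4 / 4))) ^ 2)
          * (1 + 2 * (4 : ℕ) * 3 ^ ((4 : ℕ) - 1) * (((4 : ℕ) - 1).factorial * (4 / (kappa163 4 / 16)) ^ ((4 : ℕ) - 1) * (1 + 4 / (kappa163 4 / 16))))))
        * ((((m + 1 : ℕ) : ℝ)) ^ 8)⁻¹)
      (kappa163 4 / 16 / 2 / (4 : ℕ)) := by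
  have hn : 1 ≤ m + 1 := Nat.le_add_left 1 m
  have hN0 : (0 : ℝ) < ((m + 1 : ℕ) : ℝ) := by exact_mod_cast Nat.succ_pos m
  have hσ : 0 < kappa163 4 / 16 := by have := kappa163_pos 4; positivity
  have hM5 := M5_nonneg m
  have hML : 0 ≤ cNear a := (cNear_pos ha).le
  have hL : ∀ x β : Site 4, ∑ z ∈ B (m + 1 - 1) β, |Ggh (m + 1) a x z () ()| ≤ cNear a := by
    intro x β
    refine (sum_B_abs_Ggh_le (m + 1) ha x β).trans (mul_le_of_le_one_right hML (Real.exp_le_one_iff.2 ?_))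
    have := ghDelta_pos ha
    have : 0 ≤ dist (blk (m + 1 - 1) x) β := dist_nonneg
    nlinarith
  intro z
  have h := abs_tadpole_le_of_blockRow_blockTable hn (L := Ggh (m + 1) a)
    (C := ((m + 1 : ℕ) : ℤ) • (0 : Site 4)) (C' := ((m + 1 : ℕ) : ℤ) • z) hML (by positivity) hσ hL
    (fun p x f g => abs_chiComm₂_le m hr a μ ν z p x f g)
    (fun p x f g hb => chiComm₂_eq_zero_of_blk_ne m a μ ν z hb f g)
  refine h.trans ?_
  have hc := ProfileWordCount.exp_centres_le (D := 4) (by norm_num) hn (half_pos hσ).le z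
  have hK : 0 ≤ (Fintype.card Unit : ℝ) ^ 2 *
        (cNear a * (|a| * (8 * ((MG163 4 * periodConst (kappa163 4) 3) * Real.exp (kappa163 4 / 4)) * Real.exp (2 * (kappa163 4 / 4)) * (1 + Real.exp (kappa163 4 / 4))) ^ 2)
          * (1 + 2 * (4 : ℕ) * 3 ^ ((4 : ℕ) - 1) * (((4 : ℕ) - 1).factorial * (4 / (kappa163 4 / 16)) ^ ((4 : ℕ) - 1) * (1 + 4 / (kappa163 4 / 16)))))
        * ((((m + 1 : ℕ) : ℝ)) ^ 8)⁻¹ := by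
    positivity
  calc _ = ((Fintype.card Unit : ℝ) ^ 2 *
        (cNear a * (|a| * (8 * ((MG163 4 * periodConst (kappa163 4) 3) * Real.exp (kappa163 4 / 4)) * Real.exp (2 * (kappa163 4 / 4)) * (1 + Real.exp (kappa163 4 / 4))) ^ 2)
          * (1 + 2 * (4 : ℕ) * 3 ^ ((4 : ℕ) - 1) * (((4 : ℕ) - 1).factorial * (4 / (kappa163 4 / 16)) ^ ((4 : ℕ) - 1) * (1 + 4 / (kappa163 4 / 16)))))
        * ((((m + 1 : ℕ) : ℝ)) ^ 8)⁻¹)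
        * Real.exp (-(kappa163 4 / 16 / 2 / ((m + 1 : ℕ) : ℝ)) * supNorm (((m + 1 : ℕ) : ℤ) • (0 : Site 4) - ((m + 1 : ℕ) : ℤ) • z)) := by
          field_simp
    _ ≤ _ := mul_le_mul_of_nonneg_left hc hK

end Letters

/-! ## §2 The three commutator bubbles at the tower weight -/

section Words

variable {L : ℕ} {δβ C : ℝ} (hδβ : 0 < δβ) (hC : 0 < C)
  (hG : ∀ (k : ℕ), 1 ≤ k → ∀ (n : ℕ) [NeZero n], n = L ^ k → ∀ δ' : ℝ, 0 ≤ δ' → δ' ≤ δβ →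
    (∀ x y : Site 4, |Ggh n a x y () ()| ≤ (C / (n : ℝ) ^ 2) / nrm (x - y) ^ 2 * Real.exp (-(δ' / n) * supNorm (x - y))) ∧
    (∀ (x y : Site 4) (μ : Fin 4), |Ggh n a (x + unitVec μ) y () () - Ggh n a x y () ()|
        ≤ (C / (n : ℝ) ^ 2) / nrm (x - y) ^ 3 * Real.exp (-(δ' / n) * supNorm (x - y))) ∧
    (∀ (x y : Site 4) (μ : Fin 4), |Ggh n a x (y + unitVec μ) () () - Ggh n a x y () ()|
        ≤ (C / (n : ℝ) ^ 2) / nrm (x - y) ^ 3 * Real.exp (-(δ' / n) * supNorm (x - y))))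
include hδβ hC hG

/-- [folklore] **THE FIRST CROSS WORD AT THE TOWER WEIGHT** `z ↦ bubble Ggh [P_a, χ̂_{μ,0}] 𝒱_K[K₀]_{ν,z}` (commutator side flat `≍ n⁻⁸`, `K`-side F1): `∃ K, ∀ k ≥ 1, ∀ m,
m+1 = L^k → ∀ r ∈ box 4 (m+1), ∀ μ ν, Decay510 (…) (K·(N⁸)⁻¹) r₀`. -/
theorem sharp_chiCross₁ : ∃ K : ℝ, ∀ (k : ℕ), 1 ≤ k → ∀ (m : ℕ), m + 1 = L ^ k → ∀ (r : Fin (3 + 1) → ℕ), r ∈ box (3 + 1) (m + 1) → ∀ μ ν : Fin 4,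
    Decay510 (fun z : Site 4 => bubble (Ggh (m + 1) a)
        (fun x z' (_ _ : Unit) => (bmGaugeAt (toSite r) (colH (KInvStep (d := 3) (m + 1) 0) (m + 1) μ 0) (m + 1) z'
            - bmGaugeAt (toSite r) (colH (KInvStep (d := 3) (m + 1) 0) (m + 1) μ 0) (m + 1) x)
          * (a / (((m + 1 : ℕ) : ℝ)) ^ 4 * sameBlk (m + 1 - 1) x z'))
        (vertexRedF (m + 1) (SghAt (ctrHalf (m + 1)) (m + 1) ((((m + 1 : ℕ) : ℝ)) ^ 2) 0) ν z))
      (K * ((((m + 1 : ℕ) : ℝ)) ^ 8)⁻¹) (min (kappa163 4 / 16) (2 * (δβ / 2)) / 2 / (4 : ℕ)) := by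
  have hσ : 0 < kappa163 4 / 16 := by have := kappa163_pos 4; positivity
  have hε : 0 < min (kappa163 4 / 16) (2 * (δβ / 2)) := lt_min hσ (by linarith)
  have h2 : 0 < δβ / 2 := by linarith
  exact ⟨_, fun k hk m hm r hr μ ν => by
    have hn : 1 ≤ m + 1 := Nat.le_add_left 1 m
    have hN : (1 : ℝ) ≤ ((m + 1 : ℕ) : ℝ) := by exact_mod_cast hn
    have hN0 : (0 : ℝ) < ((m + 1 : ℕ) : ℝ) := by linarith
    have hM5 := M5_nonneg m
    have hM6 := M6_nonneg m
    obtain ⟨hG0, -, -⟩ := hG k hk (m + 1) hm δβ hδβ.le le_rfl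
    obtain ⟨hG0h, -, hG2h⟩ := hG k hk (m + 1) hm (δβ / 2) h2.le (by linarith)
    have hA := fun y x z g f => abs_comp_Ggh_blockDensity_le m hC.le hδβ hG0 (y := y)
      (V := fun x z' (_ _ : Unit) => (bmGaugeAt (toSite r) (colH (KInvStep (d := 3) (m + 1) 0) (m + 1) μ y) (m + 1) z'
          - bmGaugeAt (toSite r) (colH (KInvStep (d := 3) (m + 1) 0) (m + 1) μ y) (m + 1) x) * (a / (((m + 1 : ℕ) : ℝ)) ^ 4 * sameBlk (m + 1 - 1) x z'))
      (by positivity) (fun p z' h' f' => abs_chiComm_le m hr a μ y p z' h' f') (fun p z' h' f' hb => chiComm_eq_zero_of_blk_ne m a μ y hb h' f') x z g f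
    have hB := fun y z x f g => abs_comp_Ggh_VK_le m (ctrHalf (m + 1)) hC.le h2.le hG0h hG2h ((((m + 1 : ℕ) : ℝ)) ^ 2) ν y z x f g
    have h := decay510_biBubble_of_twoTerm (D := 4) (F := Unit) (by norm_num) hn (L₁ := Ggh (m + 1) a) (L₂ := Ggh (m + 1) a)
      (𝒱 := fun μ y => fun x z' (_ _ : Unit) => (bmGaugeAt (toSite r) (colH (KInvStep (d := 3) (m + 1) 0) (m + 1) μ y) (m + 1) z'
          - bmGaugeAt (toSite r) (colH (KInvStep (d := 3) (m + 1) 0) (m + 1) μ y) (m + 1) x) * (a / (((m + 1 : ℕ) : ℝ)) ^ 4 * sameBlk (m + 1 - 1) x z'))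
      (𝒱' := vertexRedF (m + 1) (SghAt (ctrHalf (m + 1)) (m + 1) ((((m + 1 : ℕ) : ℝ)) ^ 2) 0)) μ ν
      (by positivity) le_rfl (by positivity) (by positivity) h2 hσ (by norm_num) (by norm_num) (by norm_num) (by norm_num) hA hB
    have hK₃ := K_diff_le (a' := 3) (δ := δβ / 2) hN hM5 (Real.exp_pos (kappa163 4 / 4)).le (le_refl (C / (((m + 1 : ℕ) : ℝ)) ^ 2))
    have hK₄ := K_value_le (a := 2) (δ := δβ / 2) hN (mul_nonneg hM6 (Real.exp_pos (kappa163 4 / 4)).le) (Real.exp_pos (kappa163 4 / 16)).le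
      (le_refl (C / (((m + 1 : ℕ) : ℝ)) ^ 2))
    have hK₁ : C * (|a| * (8 * ((MG163 4 * periodConst (kappa163 4) 3) * Real.exp (kappa163 4 / 4)) * Real.exp (2 * (kappa163 4 / 4)) * (1 + Real.exp (kappa163 4 / 4)))
          * ((((m + 1 : ℕ) : ℝ)) ^ 4)⁻¹ * ((((m + 1 : ℕ) : ℝ)) ^ 4)⁻¹) * Real.exp (4 * δβ) * (1 + 216 * (4 / δβ * (1 + 4 / δβ)))
        ≤ (C * (|a| * (8 * ((MG163 4 * periodConst (kappa163 4) 3) * Real.exp (kappa163 4 / 4)) * Real.exp (2 * (kappa163 4 / 4)) * (1 + Real.exp (kappa163 4 / 4))))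
            * Real.exp (4 * δβ) * (1 + 216 * (4 / δβ * (1 + 4 / δβ)))) / (((m + 1 : ℕ) : ℝ)) ^ 8 :=
      le_of_eq (by field_simp)
    exact decay510_mono_const h (fourTerm_bookkeeping hn (by positivity) (by positivity) (by positivity) le_rfl (by positivity) (by positivity)
      (by positivity) (by positivity) (by positivity) (by positivity)
      hK₁ (le_of_eq (zero_div ((((m + 1 : ℕ) : ℝ)) ^ 8)).symm) hK₃ hK₄ (by norm_num) (by norm_num) (by norm_num) (by norm_num))⟩

/-- [folklore] **THE SECOND CROSS WORD AT THE TOWER WEIGHT** `z ↦ bubble Ggh 𝒱_K[K₀]_{μ,0} [P_a, χ̂_{ν,z}]` (sides swapped). -/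
theorem sharp_chiCross₂ : ∃ K : ℝ, ∀ (k : ℕ), 1 ≤ k → ∀ (m : ℕ), m + 1 = L ^ k → ∀ (r : Fin (3 + 1) → ℕ), r ∈ box (3 + 1) (m + 1) → ∀ μ ν : Fin 4,
    Decay510 (fun z : Site 4 => bubble (Ggh (m + 1) a)
        (vertexRedF (m + 1) (SghAt (ctrHalf (m + 1)) (m + 1) ((((m + 1 : ℕ) : ℝ)) ^ 2) 0) μ 0)
        (fun x z' (_ _ : Unit) => (bmGaugeAt (toSite r) (colH (KInvStep (d := 3) (m + 1) 0) (m + 1) ν z) (m + 1) z'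
            - bmGaugeAt (toSite r) (colH (KInvStep (d := 3) (m + 1) 0) (m + 1) ν z) (m + 1) x)
          * (a / (((m + 1 : ℕ) : ℝ)) ^ 4 * sameBlk (m + 1 - 1) x z')))
      (K * ((((m + 1 : ℕ) : ℝ)) ^ 8)⁻¹) (min (kappa163 4 / 16) (2 * (δβ / 2)) / 2 / (4 : ℕ)) := by
  have hσ : 0 < kappa163 4 / 16 := by have := kappa163_pos 4; positivity
  have hε : 0 < min (kappa163 4 / 16) (2 * (δβ / 2)) := lt_min hσ (by linarith)
  have h2 : 0 < δβ / 2 := by linarith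
  exact ⟨_, fun k hk m hm r hr μ ν => by
    have hn : 1 ≤ m + 1 := Nat.le_add_left 1 m
    have hN : (1 : ℝ) ≤ ((m + 1 : ℕ) : ℝ) := by exact_mod_cast hn
    have hN0 : (0 : ℝ) < ((m + 1 : ℕ) : ℝ) := by linarith
    have hM5 := M5_nonneg m
    have hM6 := M6_nonneg m
    obtain ⟨hG0, -, -⟩ := hG k hk (m + 1) hm δβ hδβ.le le_rfl
    obtain ⟨hG0h, -, hG2h⟩ := hG k hk (m + 1) hm (δβ / 2) h2.le (by linarith)
    have hA := fun y x z g f => abs_comp_Ggh_VK_le m (ctrHalf (m + 1)) hC.le h2.le hG0h hG2h ((((m + 1 : ℕ) : ℝ)) ^ 2) μ y x z g f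
    have hB := fun y z x f g => abs_comp_Ggh_blockDensity_le m hC.le hδβ hG0 (y := y)
      (V := fun x z' (_ _ : Unit) => (bmGaugeAt (toSite r) (colH (KInvStep (d := 3) (m + 1) 0) (m + 1) ν y) (m + 1) z'
          - bmGaugeAt (toSite r) (colH (KInvStep (d := 3) (m + 1) 0) (m + 1) ν y) (m + 1) x) * (a / (((m + 1 : ℕ) : ℝ)) ^ 4 * sameBlk (m + 1 - 1) x z'))
      (by positivity) (fun p z' h' f' => abs_chiComm_le m hr a ν y p z' h' f') (fun p z' h' f' hb => chiComm_eq_zero_of_blk_ne m a ν y hb h' f') z x f g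
    have h := decay510_biBubble_of_twoTerm (D := 4) (F := Unit) (by norm_num) hn (L₁ := Ggh (m + 1) a) (L₂ := Ggh (m + 1) a)
      (𝒱 := vertexRedF (m + 1) (SghAt (ctrHalf (m + 1)) (m + 1) ((((m + 1 : ℕ) : ℝ)) ^ 2) 0))
      (𝒱' := fun ν y => fun x z' (_ _ : Unit) => (bmGaugeAt (toSite r) (colH (KInvStep (d := 3) (m + 1) 0) (m + 1) ν y) (m + 1) z'
          - bmGaugeAt (toSite r) (colH (KInvStep (d := 3) (m + 1) 0) (m + 1) ν y) (m + 1) x) * (a / (((m + 1 : ℕ) : ℝ)) ^ 4 * sameBlk (m + 1 - 1) x z'))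
      μ ν (by positivity) (by positivity) (by positivity) le_rfl h2 hσ (by norm_num) (by norm_num) (by norm_num) (by norm_num) hA hB
    have hK₁ := K_diff_le (a' := 3) (δ := δβ / 2) hN hM5 (Real.exp_pos (kappa163 4 / 4)).le (le_refl (C / (((m + 1 : ℕ) : ℝ)) ^ 2))
    have hK₂ := K_value_le (a := 2) (δ := δβ / 2) hN (mul_nonneg hM6 (Real.exp_pos (kappa163 4 / 4)).le) (Real.exp_pos (kappa163 4 / 16)).le
      (le_refl (C / (((m + 1 : ℕ) : ℝ)) ^ 2))
    have hK₃ : C * (|a| * (8 * ((MG163 4 * periodConst (kappa163 4) 3) * Real.exp (kappa163 4 / 4)) * Real.exp (2 * (kappa163 4 / 4)) * (1 + Real.exp (kappa163 4 / 4)))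
          * ((((m + 1 : ℕ) : ℝ)) ^ 4)⁻¹ * ((((m + 1 : ℕ) : ℝ)) ^ 4)⁻¹) * Real.exp (4 * δβ) * (1 + 216 * (4 / δβ * (1 + 4 / δβ)))
        ≤ (C * (|a| * (8 * ((MG163 4 * periodConst (kappa163 4) 3) * Real.exp (kappa163 4 / 4)) * Real.exp (2 * (kappa163 4 / 4)) * (1 + Real.exp (kappa163 4 / 4))))
            * Real.exp (4 * δβ) * (1 + 216 * (4 / δβ * (1 + 4 / δβ)))) / (((m + 1 : ℕ) : ℝ)) ^ 8 :=
      le_of_eq (by field_simp)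
    exact decay510_mono_const h (fourTerm_bookkeeping hn (by positivity) (by positivity) (by positivity) (by positivity) (by positivity) le_rfl
      (by positivity) (by positivity) (by positivity) (by positivity)
      hK₁ hK₂ hK₃ (le_of_eq (zero_div ((((m + 1 : ℕ) : ℝ)) ^ 8)).symm) (by norm_num) (by norm_num) (by norm_num) (by norm_num))⟩

/-- [folklore] **THE PURE χ-WORD AT THE TOWER WEIGHT** `z ↦ bubble Ggh [P_a, χ̂_{μ,0}] [P_a, χ̂_{ν,z}]` (both sides flat `≍ n⁻⁸`). -/
theorem sharp_chiPure : ∃ K : ℝ, ∀ (k : ℕ), 1 ≤ k → ∀ (m : ℕ), m + 1 = L ^ k → ∀ (r : Fin (3 + 1) → ℕ), r ∈ box (3 + 1) (m + 1) → ∀ μ ν : Fin 4,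
    Decay510 (fun z : Site 4 => bubble (Ggh (m + 1) a)
        (fun x z' (_ _ : Unit) => (bmGaugeAt (toSite r) (colH (KInvStep (d := 3) (m + 1) 0) (m + 1) μ 0) (m + 1) z'
            - bmGaugeAt (toSite r) (colH (KInvStep (d := 3) (m + 1) 0) (m + 1) μ 0) (m + 1) x)
          * (a / (((m + 1 : ℕ) : ℝ)) ^ 4 * sameBlk (m + 1 - 1) x z'))
        (fun x z' (_ _ : Unit) => (bmGaugeAt (toSite r) (colH (KInvStep (d := 3) (m + 1) 0) (m + 1) ν z) (m + 1) z'
            - bmGaugeAt (toSite r) (colH (KInvStep (d := 3) (m + 1) 0) (m + 1) ν z) (m + 1) x)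
          * (a / (((m + 1 : ℕ) : ℝ)) ^ 4 * sameBlk (m + 1 - 1) x z')))
      (K * ((((m + 1 : ℕ) : ℝ)) ^ 8)⁻¹) (min (kappa163 4 / 16) (2 * (δβ / 2)) / 2 / (4 : ℕ)) := by
  have hσ : 0 < kappa163 4 / 16 := by have := kappa163_pos 4; positivity
  have hε : 0 < min (kappa163 4 / 16) (2 * (δβ / 2)) := lt_min hσ (by linarith)
  have h2 : 0 < δβ / 2 := by linarith
  exact ⟨_, fun k hk m hm r hr μ ν => by
    have hn : 1 ≤ m + 1 := Nat.le_add_left 1 m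
    have hN0 : (0 : ℝ) < ((m + 1 : ℕ) : ℝ) := by exact_mod_cast Nat.succ_pos m
    have hM5 := M5_nonneg m
    obtain ⟨hG0, -, -⟩ := hG k hk (m + 1) hm δβ hδβ.le le_rfl
    have hA := fun y x z g f => abs_comp_Ggh_blockDensity_le m hC.le hδβ hG0 (y := y)
      (V := fun x z' (_ _ : Unit) => (bmGaugeAt (toSite r) (colH (KInvStep (d := 3) (m + 1) 0) (m + 1) μ y) (m + 1) z'
          - bmGaugeAt (toSite r) (colH (KInvStep (d := 3) (m + 1) 0) (m + 1) μ y) (m + 1) x) * (a / (((m + 1 : ℕ) : ℝ)) ^ 4 * sameBlk (m + 1 - 1) x z'))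
      (by positivity) (fun p z' h' f' => abs_chiComm_le m hr a μ y p z' h' f') (fun p z' h' f' hb => chiComm_eq_zero_of_blk_ne m a μ y hb h' f') x z g f
    have hB := fun y z x f g => abs_comp_Ggh_blockDensity_le m hC.le hδβ hG0 (y := y)
      (V := fun x z' (_ _ : Unit) => (bmGaugeAt (toSite r) (colH (KInvStep (d := 3) (m + 1) 0) (m + 1) ν y) (m + 1) z'
          - bmGaugeAt (toSite r) (colH (KInvStep (d := 3) (m + 1) 0) (m + 1) ν y) (m + 1) x) * (a / (((m + 1 : ℕ) : ℝ)) ^ 4 * sameBlk (m + 1 - 1) x z'))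
      (by positivity) (fun p z' h' f' => abs_chiComm_le m hr a ν y p z' h' f') (fun p z' h' f' hb => chiComm_eq_zero_of_blk_ne m a ν y hb h' f') z x f g
    have h := decay510_biBubble_of_twoTerm (D := 4) (F := Unit) (by norm_num) hn (L₁ := Ggh (m + 1) a) (L₂ := Ggh (m + 1) a)
      (𝒱 := fun μ y => fun x z' (_ _ : Unit) => (bmGaugeAt (toSite r) (colH (KInvStep (d := 3) (m + 1) 0) (m + 1) μ y) (m + 1) z'
          - bmGaugeAt (toSite r) (colH (KInvStep (d := 3) (m + 1) 0) (m + 1) μ y) (m + 1) x) * (a / (((m + 1 : ℕ) : ℝ)) ^ 4 * sameBlk (m + 1 - 1) x z'))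
      (𝒱' := fun ν y => fun x z' (_ _ : Unit) => (bmGaugeAt (toSite r) (colH (KInvStep (d := 3) (m + 1) 0) (m + 1) ν y) (m + 1) z'
          - bmGaugeAt (toSite r) (colH (KInvStep (d := 3) (m + 1) 0) (m + 1) ν y) (m + 1) x) * (a / (((m + 1 : ℕ) : ℝ)) ^ 4 * sameBlk (m + 1 - 1) x z'))
      μ ν (by positivity) le_rfl (by positivity) le_rfl h2 hσ (by norm_num) (by norm_num) (by norm_num) (by norm_num) hA hB
    have hK₁ : C * (|a| * (8 * ((MG163 4 * periodConst (kappa163 4) 3) * Real.exp (kappa163 4 / 4)) * Real.exp (2 * (kappa163 4 / 4)) * (1 + Real.exp (kappa163 4 / 4)))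
          * ((((m + 1 : ℕ) : ℝ)) ^ 4)⁻¹ * ((((m + 1 : ℕ) : ℝ)) ^ 4)⁻¹) * Real.exp (4 * δβ) * (1 + 216 * (4 / δβ * (1 + 4 / δβ)))
        ≤ (C * (|a| * (8 * ((MG163 4 * periodConst (kappa163 4) 3) * Real.exp (kappa163 4 / 4)) * Real.exp (2 * (kappa163 4 / 4)) * (1 + Real.exp (kappa163 4 / 4))))
            * Real.exp (4 * δβ) * (1 + 216 * (4 / δβ * (1 + 4 / δβ)))) / (((m + 1 : ℕ) : ℝ)) ^ 8 :=
      le_of_eq (by field_simp)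
    exact decay510_mono_const h (fourTerm_bookkeeping hn (by positivity) (by positivity) (by positivity) le_rfl (by positivity) le_rfl
      (by positivity) (by positivity) (by positivity) (by positivity)
      hK₁ (le_of_eq (zero_div ((((m + 1 : ℕ) : ℝ)) ^ 8)).symm) hK₁ (le_of_eq (zero_div ((((m + 1 : ℕ) : ℝ)) ^ 8)).symm)
      (by norm_num) (by norm_num) (by norm_num) (by norm_num))⟩

end Words

end Summit.QuantumFields.BalabanUV.Beta.D1BFx.GhostGaugeVariationSharp

end
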